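import Mathlib

/-!
# The archimedean exponent identity behind the BHTY infinity type `Σ + κ(1 − c)`
(kernel witness for the standard fact (A12))

Blind cell `pub-hodge-repro2`, seat p4, Tier-5 support. README §8(d): this file uses an
L-value-free non-vanishing device: NO (a kernel check of a standard fact already on the cell's
record).

The standard fact (A12) of `route/T5-route-2.md` §N5.12.6 (owner route-2, sub-step N5; used in
table N5.12.3 to match our conjugate-symplectic characters with the infinity types of [P1]/[P2] as
quoted in route-3 §G.2) reads: «every conjugate-symplectic Hecke character of E whose archimedean
components are `(z/|z|)^{n_j}` with `n_j` odd has BHTY-type `Σ + κ(1 − c)` for the CM type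
`Σ := {σ_j}` (`σ_j := ι_j` if `n_j ≤ −1`, `ῑ_j` otherwise) and `κ_{σ_j} := (|n_j| − 1)/2 ≥ 0`, after
the shift `λ := ξ|·|^{−1/2}` (… `λ_∞(z) = ∏_σ σ(z)^{−(1+κ_σ)} σc(z)^{κ_σ} = ∏_σ (σ(z)/|σ(z)|)^{−(1+2κ_σ)} |σ(z)|^{−1}`)».

At one complex place this is an identity of functions of `z ∈ ℂ^×` (`|z|_ℂ = |z|²` is the normalised
absolute value, so `|z|_ℂ^{−1/2} = |z|^{−1}`); we kernel-check it in both cases: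

* `exponent_identity_neg` — `n = −(1 + 2κ)`, `σ = ι` (identity):
  `(z/|z|)^{−(1+2κ)} · |z|^{−1} = z^{−(1+κ)} · z̄^{κ}`;
* `exponent_identity_pos` — `n = 1 + 2κ`, `σ = ῑ` (conjugation):
  `(z/|z|)^{1+2κ} · |z|^{−1} = z̄^{−(1+κ)} · z^{κ}`;
* `exponent_identity_odd` — the two cases assembled for an arbitrary odd integer `n`, with
  `κ = (|n| − 1)/2` (`kappa n`) and the CM-type choice `σ_n` (`cmEmbedding n`);
* `kappa_nonneg_cast`, `abs_eq_one_add_two_kappa` — `κ ≥ 0` and `|n| = 1 + 2κ` for odd `n`.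

Nothing about Hecke characters, CM types or L-functions is modelled: only the local exponent
bookkeeping at a complex place.

Mathlib only; no sorry; axioms ⊆ {propext, Classical.choice, Quot.sound}.
-/

namespace Summit.Ventures.HodgeRepro2.T5InfinityTypeExponents

open Complex

/-- `|z|² = z · z̄` as complex numbers. -/
theorem norm_sq_eq_mul_conj (z : ℂ) : ((‖z‖ : ℝ) : ℂ) ^ 2 = z * (starRingEnd ℂ) z := by
  rw [mul_conj, normSq_eq_norm_sq]
  push_cast
  ring

/-- The case `n = −(1 + 2κ)`, `σ = ι`: `(z/|z|)^{−(1+2κ)} · |z|^{−1} = z^{−(1+κ)} · z̄^{κ}`. -/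
theorem exponent_identity_neg (z : ℂ) (hz : z ≠ 0) (κ : ℕ) :
    (z / ‖z‖) ^ (-(1 + 2 * κ : ℤ)) * ((‖z‖ : ℝ) : ℂ)⁻¹ =
      z ^ (-(1 + κ : ℤ)) * ((starRingEnd ℂ) z) ^ κ := by
  have hr : ((‖z‖ : ℝ) : ℂ) ≠ 0 := by
    exact_mod_cast norm_ne_zero_iff.mpr hz
  have key : ((‖z‖ : ℝ) : ℂ) ^ (2 * κ) = z ^ κ * ((starRingEnd ℂ) z) ^ κ := by
    rw [pow_mul, norm_sq_eq_mul_conj, mul_pow]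
  have e1 : (-(1 + 2 * κ : ℤ)) = -((1 + 2 * κ : ℕ) : ℤ) := by push_cast; ring
  have e2 : (-(1 + κ : ℤ)) = -((1 + κ : ℕ) : ℤ) := by push_cast; ring
  rw [e1, e2, zpow_neg, zpow_neg, zpow_natCast, zpow_natCast, div_pow]
  field_simp
  linear_combination (((‖z‖ : ℝ) : ℂ) * z ^ (1 + κ)) * key

/-- The case `n = 1 + 2κ`, `σ = ῑ`: `(z/|z|)^{1+2κ} · |z|^{−1} = z̄^{−(1+κ)} · z^{κ}`. -/
theorem exponent_identity_pos (z : ℂ) (hz : z ≠ 0) (κ : ℕ) :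
    (z / ‖z‖) ^ (1 + 2 * κ : ℤ) * ((‖z‖ : ℝ) : ℂ)⁻¹ =
      ((starRingEnd ℂ) z) ^ (-(1 + κ : ℤ)) * z ^ κ := by
  have hr : ((‖z‖ : ℝ) : ℂ) ≠ 0 := by
    exact_mod_cast norm_ne_zero_iff.mpr hz
  have hc : (starRingEnd ℂ) z ≠ 0 := by
    rwa [map_ne_zero]
  have key : ((‖z‖ : ℝ) : ℂ) ^ (2 * κ + 2) = z ^ (κ + 1) * ((starRingEnd ℂ) z) ^ (κ + 1) := by
    rw [show 2 * κ + 2 = 2 * (κ + 1) by ring, pow_mul, norm_sq_eq_mul_conj, mul_pow]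
  have e1 : ((1 + 2 * κ : ℤ)) = ((1 + 2 * κ : ℕ) : ℤ) := by push_cast; ring
  have e2 : (-(1 + κ : ℤ)) = -((1 + κ : ℕ) : ℤ) := by push_cast; ring
  rw [e1, e2, zpow_neg, zpow_natCast, zpow_natCast, div_pow]
  field_simp
  linear_combination (-(z ^ κ)) * key

/-- `κ(n) := (|n| − 1)/2` (a natural number for odd `n`). -/
def kappa (n : ℤ) : ℕ := ((n.natAbs - 1) / 2 : ℕ)

/-- For odd `n`, `|n| = 1 + 2κ(n)`. -/
theorem natAbs_eq_one_add_two_kappa {n : ℤ} (hn : Odd n) : n.natAbs = 1 + 2 * kappa n := by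
  obtain ⟨k, hk⟩ := hn
  have h : Odd n.natAbs := by
    rw [Int.natAbs_odd]
    exact ⟨k, hk⟩
  obtain ⟨m, hm⟩ := h
  unfold kappa
  omega

/-- `κ(n) ≥ 0` (it is a natural number); recorded in the form used in the ledger. -/
theorem kappa_nonneg_cast (n : ℤ) : (0 : ℤ) ≤ (kappa n : ℤ) := by
  exact_mod_cast Nat.zero_le _

/-- The CM-type choice of (A12): `σ_n = ι` (identity) for `n ≤ −1`, `ῑ` (conjugation) otherwise. -/
noncomputable def cmEmbedding (n : ℤ) : ℂ →+* ℂ :=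
  if n ≤ -1 then RingHom.id ℂ else starRingEnd ℂ

/-- `σ_n` composed with conjugation. -/
noncomputable def cmEmbeddingConj (n : ℤ) : ℂ →+* ℂ :=
  (cmEmbedding n).comp (starRingEnd ℂ)

/-- THE STANDARD FACT (A12) at one complex place, for an arbitrary odd integer `n`:
`(z/|z|)^n · |z|^{−1} = σ_n(z)^{−(1+κ)} · (σ_n c)(z)^{κ}` with `κ = (|n| − 1)/2`. -/
theorem exponent_identity_odd (z : ℂ) (hz : z ≠ 0) {n : ℤ} (hn : Odd n) :
    (z / ‖z‖) ^ n * ((‖z‖ : ℝ) : ℂ)⁻¹ =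
      (cmEmbedding n z) ^ (-(1 + kappa n : ℤ)) * (cmEmbeddingConj n z) ^ kappa n := by
  have habs := natAbs_eq_one_add_two_kappa hn
  by_cases h : n ≤ -1
  · -- `n = −|n| = −(1 + 2κ)`, `σ = ι`
    have hn' : n = -(1 + 2 * kappa n : ℤ) := by
      have h1 : (n.natAbs : ℤ) = -n := Int.ofNat_natAbs_of_nonpos (by omega)
      rw [habs] at h1
      push_cast at h1
      omega
    simp only [cmEmbedding, cmEmbeddingConj, if_pos h, RingHom.id_apply, RingHom.comp_apply]
    have := exponent_identity_neg z hz (kappa n)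
    rw [← hn'] at this
    exact this
  · -- `n = |n| = 1 + 2κ`, `σ = ῑ`
    have hn' : n = (1 + 2 * kappa n : ℤ) := by
      have h1 : (n.natAbs : ℤ) = n := Int.natAbs_of_nonneg (by omega)
      rw [habs] at h1
      push_cast at h1
      omega
    simp only [cmEmbedding, cmEmbeddingConj, if_neg h, RingHom.comp_apply, Complex.conj_conj]
    have := exponent_identity_pos z hz (kappa n)
    rw [← hn'] at this
    exact this

end Summit.Ventures.HodgeRepro2.T5InfinityTypeExponents
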